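import Summits.ResolutionOfSingularities.ResolutionOfSingularities.Theorems.CossartPiltant2019PrincipalizationHolds
import Literature.AlgebraicGeometry.Resolution.BadCurveInduction
import HarnessLib

/-!
# Cossart–Piltant 2019 patching (`CossartPiltant2019Patching`, F-77b) from principalization (F-77)

OURS (res-inputs-p-8a g2; critic R143 (4) / R145, plan-1 allocation). The tree's reduction
`CossartPiltant2019Patching.of_principalization : CossartPiltant2019Principalization → CossartPiltant2019Patching`
(`BadCurveInduction.lean` :125 — Zariski's Patching Theorem for `P = P_reg` via the bad-curve induction) applied to the
tree theorem `CP2008Prop44.CossartPiltant2019Principalization_holds` (F-77, `…CossartPiltant2019PrincipalizationHolds.lean`,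
itself from F-71 `cossartPiltant2008_prop44_holds`). Three-line composition; nothing else is claimed. AI-written; AI review
weaker than expert review. This proves the TREE's Lean statement `Literature.AlgebraicGeometry.Resolution.CossartPiltant2019Patching`
(«resolution in dimension ≤ 2 and local uniformization in dimension three over a field `k` give resolution up to dimension three
over `k`») and nothing else: local uniformization itself is NOT proved here, resolution in dimension `≥ 4` / positive
characteristic is NOT proved, no statement of a manuscript under adjudication is proved.
-/

-- `Summit.<Summit>.<Sub>.Theorems` with `Sub = Summit` (single-conjunct summit, D-0017)
set_option linter.dupNamespace false

noncomputable section

open Literature.AlgebraicGeometry.Resolution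

namespace Summit.ResolutionOfSingularities.ResolutionOfSingularities.Theorems

namespace CP2008Prop44

universe u

/-- **F-77b: the Cossart–Piltant 2019 patching statement of the tree HOLDS** — from F-77
(`CossartPiltant2019Principalization_holds`) by the landed reduction `CossartPiltant2019Patching.of_principalization`.
[cite: CossartPiltant2019, Thm. 1.1 and Prop. 4.6] [cite: Piltant2013, Prop. 5.1] [cite: CossartPiltant2008, Prop. 4.4] -/
theorem CossartPiltant2019Patching_holds : CossartPiltant2019Patching.{u} :=
  CossartPiltant2019Patching.of_principalization CossartPiltant2019Principalization_holds

end CP2008Prop44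

end Summit.ResolutionOfSingularities.ResolutionOfSingularities.Theorems

end
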